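import Mathlib.NumberTheory.Padics.Complex
import Mathlib.NumberTheory.Padics.WithVal
import Literature.NumberTheory.EllipticCurves.EisensteinSeriesNebentypusQExpansion
import Literature.NumberTheory.LFunctions.DirichletLValueBernoulli
import HarnessLib

/-!
# The normalised Eisenstein series `E_k^{𝟙,χ} = -B_{k,χ}/2k + ∑ σ_{k-1}^χ(n) qⁿ` and the
# `p`-integrality of its `q`-expansion

Topic `Literature/NumberTheory/EllipticCurves`; namespace
`Literature.NumberTheory.EllipticCurves.ModularForms`.  THEOREMS ONLY (no definition, no named
fact).

Let `χ` be a PRIMITIVE Dirichlet character modulo `N ≥ 1` with `χ(-1) = (-1)^k`, `k ≥ 3`.  The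
tree's Eisenstein series with nebentypus `E_k^χ = ∑_{u ∈ (ℤ/N)ˣ} χ(u)⁻¹ E_{k,(0,u)}`
(`eisensteinCharMF N k χ`, a modular form of weight `k` on `Γ₁(N)` of nebentypus `χ`, value `2`
at `i∞`) has, by `EisensteinSeriesNebentypusQExpansion` and `DirichletLValueBernoulli`, the
`q`-expansion

  `E_k^χ = 2 - (4k/B_{k,χ}) ∑_{n ≥ 1} σ_{k-1}^χ(n) qⁿ`,  `σ_{k-1}^χ(n) = ∑_{d ∣ n} χ(d) d^{k-1}`

(`qExpansion_coeff_eisensteinCharMF_eq`), where `B_{k,χ} = N^{k-1} ∑_{c mod N} χ(c) B_k(c/N) ≠ 0`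
is the generalized Bernoulli number (`GeneralizedBernoulliNumbers`).  Hence the modular form

  `E_k^{𝟙,χ} := -(B_{k,χ}/4k) • E_k^χ = -B_{k,χ}/2k + ∑_{n ≥ 1} σ_{k-1}^χ(n) qⁿ`

(`qExpansion_coeff_bernoulli_smul_eisensteinCharMF`) is exactly the Eisenstein series
`E_k^{χ₁,χ₂}` of Billerey–Menares §1.3 / Miyake Thm. 7.1.3 for `χ₁ = 𝟙` (modulus `N₁ = 1`) and
`χ₂ = χ`: constant term `-δ(χ₁) B_{k,χ₂}/2k`, `σ_{k-1}^{χ₁,χ₂}(n) = ∑_{d ∣ n} χ₁(n/d) χ₂(d) d^{k-1}`.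

**Integrality** (`qExpansion_coeff_bernoulli_smul_eisensteinCharMF_mem`,
`valuation_qExpansion_coeff_bernoulli_smul_eisensteinCharMF_le_one`): for a prime `p` with
`p ∤ N` and `k < p - 1` (so `p ≥ 5`, `p ∤ 2k`), every coefficient of `E_k^{𝟙,χ}` lies in any
subring of `ℂ` containing the values of `χ` and the `p`-integral rationals — in particular it is a
`p`-adic integer under every identification `ι : ℚ̄_p ≃ ℂ` (`‖ι⁻¹(a_n)‖_p ≤ 1`).  This is the
`p`-integrality of `B_{k,χ}/2k` for `p > k + 1`, `p ∤ N` (Billerey–Menares Lemma 3, proved in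
`GeneralizedBernoulliNumbers` from von Staudt–Clausen) — the standing integrality input of
Billerey–Menares §3.2.

## References

* N. Billerey, R. Menares, *Strong modularity of reducible Galois representations*, Trans. AMS
  370 (2018), §1.3 (the series `E_k^{χ₁,χ₂}`, (7.1.3)), Lemma 3, §3.2. [BillereyMenares2018]
* T. Miyake, *Modular Forms*, Springer (1989), Thm. 7.1.3, (7.1.13). [Miyake1989]
* F. Diamond, J. Shurman, *A First Course in Modular Forms*, GTM 228 (2005), Thm. 4.5.1,
  §4.7. [DiamondShurman2005]
-/

noncomputable section

open Complex UpperHalfPlane Filter Finset ModularForm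
open scoped Real NNReal
open Literature.NumberTheory.LFunctions

namespace Literature.NumberTheory.EllipticCurves.ModularForms

/-! ### The `q`-expansion of `E_k^χ` and of `E_k^{𝟙,χ}` in Bernoulli form -/

section Coefficients

variable {N : ℕ} [NeZero N] (k : ℕ) (χ : DirichletCharacter ℂ N)

omit [NeZero N] in
/-- `χ̄(-1) = χ(-1)` (`χ(-1) = ±1`). [folklore] -/
theorem inv_apply_neg_one : χ⁻¹ (-1) = χ (-1) := by
  rw [MulChar.inv_apply_eq_inv']
  refine inv_eq_of_mul_eq_one_left ?_
  rw [← map_mul, neg_one_mul, neg_neg, map_one]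

/-- `B_{k,χ} ≠ 0` for a primitive `χ` with `χ(-1) = (-1)^k`, `k ≥ 2`. [cite: Apostol1976, Thm. 12.19 with Thm. 8.15] -/
theorem generalizedBernoulli_ne_zero (hχ : χ.IsPrimitive) {k : ℕ} (hk : 2 ≤ k)
    (hpar : χ (-1) = (-1) ^ k) : generalizedBernoulli k χ ≠ 0 := by
  have h := generalizedBernoulli_inv_ne_zero χ⁻¹ (isPrimitive_inv χ hχ) hk
    (by rw [inv_apply_neg_one, hpar])
  simpa only [inv_inv] using h

/-- **The `q`-expansion of `E_k^χ` in Bernoulli form** (`χ` primitive, `χ(-1) = (-1)^k`,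
`k ≥ 3`): `a_0 = 2` and `a_n = -(4k/B_{k,χ}) ∑_{d ∣ n} χ(d) d^{k-1}` for `n ≥ 1`.
[cite: BillereyMenares2018, §1.3 (7.1.3); Miyake1989, Thm. 7.1.3] -/
theorem qExpansion_coeff_eisensteinCharMF_eq (hk : 3 ≤ k) (hχ : χ.IsPrimitive)
    (hpar : χ (-1) = (-1) ^ k) (n : ℕ) :
    (qExpansion 1 ⇑(eisensteinCharMF N k χ (by exact_mod_cast hk))).coeff n =
      if n = 0 then 2 else
        -(4 * k) / generalizedBernoulli k χ * ∑ d ∈ n.divisors, χ d * (d : ℂ) ^ (k - 1) := by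
  have hψ : χ⁻¹.IsPrimitive := isPrimitive_inv χ hχ
  have hpar' : χ⁻¹ (-1) = (-1) ^ k := by rw [inv_apply_neg_one, hpar]
  have h := qExpansion_coeff_eisensteinCharMF k χ⁻¹ hk hψ hpar' n
  rw [eisenstein_normalising_const χ⁻¹ hψ (by omega) hpar'] at h
  simpa only [inv_inv] using h

/-- **The normalised Eisenstein series `E_k^{𝟙,χ} = -(B_{k,χ}/4k) • E_k^χ` has `q`-expansion
`-B_{k,χ}/2k + ∑_{n ≥ 1} (∑_{d ∣ n} χ(d) d^{k-1}) qⁿ`** (`χ` primitive modulo `N`,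
`χ(-1) = (-1)^k`, `k ≥ 3`) — the series `E_k^{χ₁,χ₂}` of Billerey–Menares / Miyake with
`χ₁ = 𝟙` (modulus `1`), `χ₂ = χ`. [cite: BillereyMenares2018, §1.3 (7.1.3); Miyake1989, Thm. 7.1.3] -/
theorem qExpansion_coeff_bernoulli_smul_eisensteinCharMF (hk : 3 ≤ k) (hχ : χ.IsPrimitive)
    (hpar : χ (-1) = (-1) ^ k) (n : ℕ) :
    (qExpansion 1 ⇑((-(generalizedBernoulli k χ) / (4 * k)) •
        eisensteinCharMF N k χ (by exact_mod_cast hk))).coeff n =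
      if n = 0 then -(generalizedBernoulli k χ) / (2 * k)
      else ∑ d ∈ n.divisors, χ d * (d : ℂ) ^ (k - 1) := by
  have hB := generalizedBernoulli_ne_zero χ hχ (by omega : 2 ≤ k) hpar
  have hk0 : (k : ℂ) ≠ 0 := by exact_mod_cast (show k ≠ 0 by omega)
  have h1 : (1 : ℝ) ∈ (CongruenceSubgroup.Gamma1 N : Subgroup (GL (Fin 2) ℝ)).strictPeriods := by
    simp
  rw [IsGLPos.coe_smul, ModularForm.qExpansion_smul one_pos h1, map_smul,
    qExpansion_coeff_eisensteinCharMF_eq k χ hk hχ hpar n, smul_eq_mul]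
  split_ifs
  · ring
  · field_simp

end Coefficients

/-! ### `p`-integrality of the coefficients of `E_k^{𝟙,χ}` -/

section Integrality

variable {N : ℕ} [NeZero N] (k : ℕ) (χ : DirichletCharacter ℂ N) {p : ℕ} [Fact p.Prime]

/-- `p ∤ 2k` when `3 ≤ k < p - 1`. [folklore] -/
theorem not_dvd_two_mul (hk : 3 ≤ k) (hkp : k < p - 1) : ¬ p ∣ 2 * k := by
  intro h
  rcases (Nat.Prime.dvd_mul Fact.out).1 h with h2 | h2
  · have := Nat.le_of_dvd (by norm_num) h2
    omega
  · have := Nat.le_of_dvd (by omega) h2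
    omega

/-- **The coefficients of `E_k^{𝟙,χ}` lie in every subring of `ℂ` containing the values of `χ`
and the `p`-integral rationals**, for `p ∤ N`, `3 ≤ k < p - 1` (the constant term
`-B_{k,χ}/2k` by the `p`-integrality of `B_{k,χ}` — von Staudt–Clausen — and `p ∤ 2k`; the
higher coefficients `∑_{d ∣ n} χ(d) d^{k-1}` trivially). [cite: BillereyMenares2018, Lemma 3 and §3.2] -/
theorem qExpansion_coeff_bernoulli_smul_eisensteinCharMF_mem (hk : 3 ≤ k) (hχ : χ.IsPrimitive)
    (hpar : χ (-1) = (-1) ^ k) (S : Subring ℂ) (hχS : ∀ j, χ j ∈ S)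
    (hS : ∀ q : ℚ, Rat.padicValuation p q ≤ 1 → algebraMap ℚ ℂ q ∈ S) (hN : ¬ p ∣ N)
    (hkp : k < p - 1) (n : ℕ) :
    (qExpansion 1 ⇑((-(generalizedBernoulli k χ) / (4 * k)) •
        eisensteinCharMF N k χ (by exact_mod_cast hk))).coeff n ∈ S := by
  rw [qExpansion_coeff_bernoulli_smul_eisensteinCharMF k χ hk hχ hpar n]
  split_ifs
  · have hB := generalizedBernoulli_mem_subring χ S hχS hS hN hkp (k := k)
    have hq : Rat.padicValuation p (-(1 / (2 * k)) : ℚ) ≤ 1 := by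
      rw [Valuation.map_neg, map_div₀, map_one,
        show ((2 * k : ℚ)) = ((2 * k : ℕ) : ℚ) by push_cast; ring,
        padicValuation_natCast_eq_one (not_dvd_two_mul k hk hkp), div_one]
    have h := Subring.mul_mem S hB (hS _ hq)
    convert h using 1
    rw [map_neg, map_div₀, map_one, map_mul, map_natCast, eq_ratCast, Rat.cast_ofNat]
    ring
  · refine Subring.sum_mem S fun d _ ↦ Subring.mul_mem S (hχS d) ?_
    exact Subring.pow_mem S (natCast_mem S d) _

/-- A root of unity of a valued field has valuation `1`. [folklore] -/
theorem valuation_eq_one_of_pow_eq_one {K : Type*} [Field K] [Valued K ℝ≥0] {x : K} {m : ℕ}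
    (hm : m ≠ 0) (hx : x ^ m = 1) : Valued.v x = 1 := by
  have h := congrArg Valued.v hx
  rw [map_pow, map_one] at h
  exact (pow_eq_one_iff_of_nonneg zero_le hm).1 h

/-- The values of a Dirichlet character, transported to `ℚ̄_p` along a ring isomorphism
`ι : ℚ̄_p ≃ ℂ`, are `p`-adic integers (`0` or roots of unity). [folklore] -/
theorem valuation_ringEquiv_symm_apply_le_one (ι : PadicAlgCl p ≃+* ℂ) (j : ZMod N) :
    Valued.v (ι.symm (χ j)) ≤ 1 := by
  by_cases hj : IsUnit j
  · obtain ⟨u, rfl⟩ := hj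
    have hpow : (ι.symm (χ u)) ^ Fintype.card (ZMod N)ˣ = 1 := by
      rw [← map_pow, ← map_pow, ← Units.val_pow_eq_pow_val, pow_card_eq_one, Units.val_one,
        map_one, map_one]
    exact (valuation_eq_one_of_pow_eq_one Fintype.card_ne_zero hpow).le
  · rw [MulChar.map_nonunit χ hj, map_zero, Valuation.map_zero]
    exact zero_le

/-- `p`-integral rationals are `p`-adic integers of `ℚ̄_p` (under any `ι : ℚ̄_p ≃ ℂ`,
`ι⁻¹(q) = q`). [folklore] -/
theorem valuation_ringEquiv_symm_ratCast_le_one (ι : PadicAlgCl p ≃+* ℂ) {q : ℚ}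
    (hq : Rat.padicValuation p q ≤ 1) : Valued.v (ι.symm (algebraMap ℚ ℂ q)) ≤ 1 := by
  rw [eq_ratCast, map_ratCast, PadicAlgCl.valuation_def,
    show ((q : PadicAlgCl p)) = ((q : ℚ_[p]) : PadicAlgCl p) by
      rw [map_ratCast (algebraMap ℚ_[p] (PadicAlgCl p))]]
  rw [← NNReal.coe_le_coe, coe_nnnorm, NNReal.coe_one, PadicAlgCl.norm_extends]
  exact (Padic.norm_rat_le_one_iff_padicValuation_le_one p).2 hq

/-- **The `q`-expansion of `E_k^{𝟙,χ}` is `p`-integral**: for `χ` primitive modulo `N` with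
`χ(-1) = (-1)^k`, `3 ≤ k < p - 1`, `p ∤ N`, and any ring isomorphism `ι : ℚ̄_p ≃ ℂ`, every
coefficient `a_n` of `-(B_{k,χ}/4k) • E_k^χ` satisfies `‖ι⁻¹(a_n)‖_p ≤ 1`.
[cite: BillereyMenares2018, Lemma 3 and §3.2] -/
theorem valuation_qExpansion_coeff_bernoulli_smul_eisensteinCharMF_le_one (ι : PadicAlgCl p ≃+* ℂ)
    (hk : 3 ≤ k) (hχ : χ.IsPrimitive) (hpar : χ (-1) = (-1) ^ k) (hN : ¬ p ∣ N)
    (hkp : k < p - 1) (n : ℕ) :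
    Valued.v (ι.symm ((qExpansion 1 ⇑((-(generalizedBernoulli k χ) / (4 * k)) •
        eisensteinCharMF N k χ (by exact_mod_cast hk))).coeff n)) ≤ 1 := by
  set S : Subring ℂ :=
    ((Valued.v (R := PadicAlgCl p)).valuationSubring.toSubring).comap ι.symm.toRingHom with hS
  have hmem : ∀ x : ℂ, x ∈ S ↔ Valued.v (ι.symm x) ≤ 1 := fun x ↦ by
    simp [hS, Valuation.mem_valuationSubring_iff]
  rw [← hmem]
  refine qExpansion_coeff_bernoulli_smul_eisensteinCharMF_mem k χ hk hχ hpar S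
    (fun j ↦ (hmem _).2 (valuation_ringEquiv_symm_apply_le_one χ ι j))
    (fun q hq ↦ (hmem _).2 (valuation_ringEquiv_symm_ratCast_le_one ι hq)) hN hkp n

end Integrality

end Literature.NumberTheory.EllipticCurves.ModularForms
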